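import Summits.Ventures.CertifiedManyBodySolver.Observables.ThermalRungLeaves
import HarnessLib

/-!
# Ventures/CertifiedManyBodySolver — Theorems/ThermalFreeEnergyWindowTrivial.lean
# NEGATIVE KNOWLEDGE OF RECORD: the thermal free-energy WINDOW leaf is vacuous as typed (statement defect found pre-birth; RULING R117)

HONEST FRAMING: this file proves NOTHING about the Hubbard model. It records that the leaf family
`S3ThermalFreeEnergyWindowAt_U8_b8 w := ∃ lo hi : ℚ, hi − lo ≤ w ∧ lo ≤ f ∧ f ≤ hi` of `Observables/ThermalRungLeaves.lean`
(`f := −pressureTT' 8 1 0 8 (7/8) / 8`, ONE defined real number) holds for EVERY `w > 0` by density of `ℚ` in `ℝ` alone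
(`exists_rat_btwn`, `hi := lo + w`): no certificate, no cluster, no property of the model enters. Consequently the `@[conjecture]`
leaf `S3ThermalFreeEnergyWindow_U8_b8_le_1o50` is closed here — proved-TRIVIAL, the honest record — and the rung
`S3ThermalRung1_n7o8_tp0` is EQUIVALENT to its Kosterlitz–Thouless conjunct `S3ThermalTcTenthRay_n7o8_tp0`. The existential over `ℚ`
does not encode «certified»: the M3 grammar of `Observables/RungLeaves.lean` (`∃ lo hi, … ∧ ∀ ω of the class, lo ≤ O(ω) ≤ hi`) carries
content only through its inner `∀ ω`, which a single number lacks; width `0` says `f ∈ ℚ`, not a window either (`…_zero_iff`).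

Found pre-birth by the D-0154 (1) refuter seats hub-tc-therm-crit-2 ∕ hub-tc-therm-crit-1 (cell `pub/hubbard-tc`, 2026-08-28); RULING R117
(hubbard-tc-lead g9): route «hubbard-tc-thermcert-1» drops crux K3, closes_target := `S3ThermalTcTenthRay_n7o8_tp0` (label S3thermRay10); the
director's free-energy-window milestone is carried as an ARTIFACT on literal two-sided bracket rows
(`Certificates/HubbardSquare_n7o8_tp0_thermal_pressureBrackets_betaGrid.lean`: `q⁻ ≤ pressureTT' β 1 0 8 (7/8) ≤ q⁺`, milestone `q⁺ − q⁻ ≤ 4/25`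
at `β·t = 8` checked on the literals), never as an `∃`-over-`ℚ` Prop. No number of record moves; NO lower bound on `T_c` is claimed anywhere.
Zero compute; no `sorry`; axioms ⊆ {propext, Classical.choice, Quot.sound}.

References: Israel1979 Thm. I.2.4 (the pressure is a number — which is exactly why the window grammar is empty).
-/

namespace Summit.Ventures.CertifiedManyBodySolver.Theorems

open Summit.Ventures.CertifiedManyBodySolver.Observables.ThermalRungLeaves
open Literature.MathematicalPhysics.QuantumLattice.ThermodynamicLimit

/-- Every real number lies in a rational window of every prescribed positive rational width (`exists_rat_btwn`, `hi := lo + w`).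
[cite: Israel1979, Thm. I.2.4] -/
theorem exists_rat_window_of_pos (x : ℝ) {w : ℚ} (hw : 0 < w) :
    ∃ lo hi : ℚ, hi - lo ≤ w ∧ ((lo : ℚ) : ℝ) ≤ x ∧ x ≤ ((hi : ℚ) : ℝ) := by
  have hw' : (0 : ℝ) < (w : ℝ) := by exact_mod_cast hw
  obtain ⟨lo, hlo₁, hlo₂⟩ := exists_rat_btwn (show x - (w : ℝ) < x by linarith)
  refine ⟨lo, lo + w, by simp, hlo₂.le, ?_⟩
  push_cast
  linarith

/-- **The window family is inhabited at EVERY positive width, certificate-free** — the statement defect. [cite: Israel1979, Thm. I.2.4] -/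
theorem S3ThermalFreeEnergyWindowAt_U8_b8_of_pos {w : ℚ} (hw : 0 < w) : S3ThermalFreeEnergyWindowAt_U8_b8 w :=
  exists_rat_window_of_pos _ hw

/-- **The `@[conjecture]` leaf `S3ThermalFreeEnergyWindow_U8_b8_le_1o50` is a theorem of `exists_rat_btwn`** (proved-TRIVIAL; R117).
[cite: Israel1979, Thm. I.2.4] -/
theorem S3ThermalFreeEnergyWindow_U8_b8_le_1o50_trivial : S3ThermalFreeEnergyWindow_U8_b8_le_1o50 :=
  S3ThermalFreeEnergyWindowAt_U8_b8_of_pos (by norm_num)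

/-- **Hence RUNG 1 ↔ LEAF 1**: the free-energy conjunct adds nothing to `S3ThermalRung1_n7o8_tp0`; routes close `S3ThermalTcTenthRay_n7o8_tp0`.
[cite: HazraVermaRanderia2019, eqs. (2)–(4)] -/
theorem S3ThermalRung1_n7o8_tp0_iff_tenthRay : S3ThermalRung1_n7o8_tp0 ↔ S3ThermalTcTenthRay_n7o8_tp0 :=
  ⟨fun h => h.1, fun h => ⟨h, S3ThermalFreeEnergyWindow_U8_b8_le_1o50_trivial⟩⟩

/-- Width `0` is the only member of the family not closed by density, and it says `f ∈ ℚ` — not a window statement either.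
[cite: Israel1979, Thm. I.2.4] -/
theorem S3ThermalFreeEnergyWindowAt_U8_b8_zero_iff :
    S3ThermalFreeEnergyWindowAt_U8_b8 0 ↔ ∃ q : ℚ, -(pressureTT' 8 1 0 8 (7 / 8)) / 8 = ((q : ℚ) : ℝ) := by
  constructor
  · rintro ⟨lo, hi, hwid, hlo, hhi⟩
    have hle : ((hi : ℚ) : ℝ) ≤ ((lo : ℚ) : ℝ) := by exact_mod_cast (show hi ≤ lo by linarith)
    exact ⟨lo, le_antisymm (hhi.trans hle) hlo⟩
  · rintro ⟨q, hq⟩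
    exact ⟨q, q, by simp, hq.ge, hq.le⟩

/-- The same three lines close the window grammar around ANY real at ANY positive width (e.g. `10⁻⁹`): the typed family cannot express
precision at all — which is why the milestone lives on literal bracket rows. [cite: Israel1979, Thm. I.2.4] -/
theorem any_real_has_rat_window (x : ℝ) :
    ∃ lo hi : ℚ, hi - lo ≤ 1 / 1000000000 ∧ ((lo : ℚ) : ℝ) ≤ x ∧ x ≤ ((hi : ℚ) : ℝ) :=
  exists_rat_window_of_pos x (by norm_num)

end Summit.Ventures.CertifiedManyBodySolver.Theorems
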